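import Summits.Ventures.HSemireg.WedgeHankelSubstitutionJordanPartition
import Summits.Ventures.HSemireg.WedgeHankelClassSpaceIrreducible
import Summits.Ventures.HSemireg.WedgeHankelSubstitutionParabolicCharP

/-!
# Venture HSemireg — THE SWAP `SbC(0 1 1 0)` PERMUTES TH-7's SPIKES BY `E_p ↦ E_{n−p}`; its fixed classes are the PALINDROMIC classes, and for `2 ≠ 0` the class space splits
# as `ker(S − 1) ⊕ ker(S + 1)` with `dim ker(S − 1) = ⌊n/2⌋ + 1` (palindromes `E_p + E_{n−p}`) and `dim ker(S + 1) = ⌈n/2⌉` (anti-palindromes `E_p − E_{n−p}`)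

HONEST FRAMING. Part of the Lean index of the computation cell `pub-hsemireg` (seat p10 gen 21, Sunday typer «UNIFORM-IN-n»).
Finite-dimensional EXTERIOR ALGEBRA + linear algebra ONLY: no variety, no cohomology theory, no sheaf, no Ext group, no semiregularity map;
nothing here says that HC / HC_CM / HC_AV holds; no Literature fact is declared or used.  Custodian versions as in `WedgeHankelSiegelIdeal` (1/3) and `WedgeHankelFrameChange`;
the dictionary (the swap `x ↔ y` reverses binary forms; its `±1`-eigenspaces in `Sym^n` are the (anti)palindromic forms) is QUOTED, never asserted.

WHAT IS IN THE TREE.  J9/J12: `Sb_swap_w_spike_top` / `_zero` (`E_n ↔ E_0`); J11 `SbC_swap_mul_swap` (`S² = 1`); K2 `minpoly_SbC_swap` (`(X−1)(X+1)`, `2 ≠ 0`); H5 `Sb_zero_eq_Ψs_Sb_lower`,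
I4 `Sb_diag_w`, E `Ψs_w` / `rev`; K1 `linearIndependent_of_repr_pivot`.  THIS FILE (namespace `Summit.Ventures.HSemireg.Wedge.HankelFrameChange` continued; imports K1, J9) pins
the eigenspaces of the swap (imports also J11 for `SbC_swap_mul_swap`):
* §296 **`Sb_swap_w`** (`Sb(0 1 1 0)(w_n q) = w_n(rev q)`), **`SbC_swap_spikeBasis`** (`SbC(0 1 1 0) E_p = E_{rev p}`, `rev p = n − p`), `SbC_swap_eq_sum`, **`repr_SbC_swap`**
  (`repr (S v) a = repr v (rev a)`), **`mem_ker_SbC_swap_sub_one_iff`** (fixed ⇔ palindromic coordinates), `mem_ker_SbC_swap_add_one_iff` (anti-palindromic).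
* §297 `2 ≠ 0`: `ker_SbC_swap_sub_one_inf_add_one_eq_bot`, the palindromes **`linearIndependent_spike_add_rev`** (`E_a + E_{rev a}`, `a ≤ n/2`) and anti-palindromes
  **`linearIndependent_spike_sub_rev`** (`E_a − E_{rev a}`, `2a < n`), hence **`finrank_ker_SbC_swap_sub_one`: `dim ker(SbC(0 1 1 0) − 1) = n/2 + 1`** and
  **`finrank_ker_SbC_swap_add_one`: `dim ker(SbC(0 1 1 0) + 1) = (n+1)/2`**, `ker_SbC_swap_sub_one_sup_add_one_eq_top` (the class space is their direct sum).
NOT typed here: characteristic `2` (the swap is then unipotent, `(S − 1)² = 0`, with `⌈(n+1)/2⌉` blocks); the quarter turn's eigenspaces; anything Ext-side.  New names only.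
-/

open Module

namespace Summit.Ventures.HSemireg.Wedge.HankelFrameChange

open Summit.Ventures.HSemireg.Wedge Summit.Ventures.HSemireg.Wedge.Kunneth Summit.Ventures.HSemireg.Wedge.Hankel
  Summit.Ventures.HSemireg.Wedge.BasisFree Summit.Ventures.HSemireg.Wedge.HankelSiegel Summit.Ventures.HSemireg.Wedge.HankelSiegelIdeal
  Summit.Ventures.HSemireg.Wedge.KunnethKernel Summit.Ventures.HSemireg.Wedge.HankelRankOne Summit.Ventures.HSemireg.Wedge.KernelDuality

variable (K : Type*) [Field K] {n : ℕ}

/-! ## §296. The swap permutes the spikes; fixed classes are palindromes -/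

/-- **`Sb(0 1 1 0)(w_n q) = w_n(rev q)`**: the swap reverses the coefficient sequence of a class (H5 + I4 + E). -/
theorem Sb_swap_w (q : ℕ → K) : Sb K 0 1 1 0 (w K n n q) = w K n n (rev K n q) := by
  rw [Sb_zero_eq_Ψs_Sb_lower, Sb_diag_w K 1 1 le_rfl, Ψs_w K le_rfl]
  refine w_eq_of_agree K n fun j hj => ?_
  rw [rev_apply_of_le K hj, rev_apply_of_le K hj, one_pow, one_pow, one_mul, one_mul]

/-- **`SbC(0 1 1 0) E_p = E_{rev p}`** (`rev p = n − p`): the swap permutes th-7's spike basis by reversal. -/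
theorem SbC_swap_spikeBasis (p : Fin (n + 1)) : SbC K 0 1 1 0 (spikeBasis K n p) = spikeBasis K n (Fin.rev p) := by
  apply Subtype.ext
  rw [SbC_apply_coe, spikeBasis_coe, spikeBasis_coe, Sb_swap_w]
  refine w_eq_of_agree K n fun j hj => ?_
  rw [rev_apply_of_le K hj, Fin.val_rev]
  by_cases h : j = n + 1 - ((p : ℕ) + 1)
  · rw [if_pos h, if_pos (by have := p.2; omega)]
  · rw [if_neg h, if_neg (by have := p.2; omega)]

/-- `SbC(0 1 1 0) v = Σ_p (repr v p) • E_{rev p}`. -/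
theorem SbC_swap_eq_sum (v : spikeSpan K n) : SbC K 0 1 1 0 v = ∑ p : Fin (n + 1), (spikeBasis K n).repr v p • spikeBasis K n (Fin.rev p) := by
  conv_lhs => rw [← (spikeBasis K n).sum_repr v]
  rw [map_sum]
  exact Finset.sum_congr rfl fun p _ => by rw [map_smul, SbC_swap_spikeBasis]

/-- **`repr (SbC(0 1 1 0) v) a = repr v (rev a)`**: the swap reverses coordinates. -/
theorem repr_SbC_swap (v : spikeSpan K n) (a : Fin (n + 1)) : (spikeBasis K n).repr (SbC K 0 1 1 0 v) a = (spikeBasis K n).repr v (Fin.rev a) := by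
  rw [SbC_swap_eq_sum, ← Equiv.sum_comp Fin.revPerm (fun p => (spikeBasis K n).repr v p • spikeBasis K n (Fin.rev p))]
  simp only [Fin.revPerm_apply, Fin.rev_rev]
  rw [show (∑ p : Fin (n + 1), (spikeBasis K n).repr v (Fin.rev p) • spikeBasis K n p) = ∑ p : Fin (n + 1), (fun p => (spikeBasis K n).repr v (Fin.rev p)) p • spikeBasis K n p
    from rfl, Basis.repr_sum_self]

/-- **THE FIXED CLASSES OF THE SWAP ARE THE PALINDROMES: `v ∈ ker(SbC(0 1 1 0) − 1) ⇔ repr v a = repr v (rev a)` for all `a`.** -/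
theorem mem_ker_SbC_swap_sub_one_iff (v : spikeSpan K n) :
    v ∈ LinearMap.ker (SbC K 0 1 1 0 (n := n) - 1) ↔ ∀ a : Fin (n + 1), (spikeBasis K n).repr v a = (spikeBasis K n).repr v (Fin.rev a) := by
  rw [LinearMap.mem_ker, LinearMap.sub_apply, Module.End.one_apply, sub_eq_zero, ← (spikeBasis K n).repr.injective.eq_iff, Finsupp.ext_iff]
  exact forall_congr' fun a => by rw [repr_SbC_swap, eq_comm]

/-- the anti-fixed classes are the anti-palindromes: `v ∈ ker(SbC(0 1 1 0) + 1) ⇔ repr v a = − repr v (rev a)` for all `a`. -/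
theorem mem_ker_SbC_swap_add_one_iff (v : spikeSpan K n) :
    v ∈ LinearMap.ker (SbC K 0 1 1 0 (n := n) + 1) ↔ ∀ a : Fin (n + 1), (spikeBasis K n).repr v a = -(spikeBasis K n).repr v (Fin.rev a) := by
  rw [LinearMap.mem_ker, LinearMap.add_apply, Module.End.one_apply, add_eq_zero_iff_neg_eq, eq_comm, ← (spikeBasis K n).repr.injective.eq_iff, Finsupp.ext_iff]
  exact forall_congr' fun a => by rw [map_neg, Finsupp.neg_apply, repr_SbC_swap]

/-! ## §297. `2 ≠ 0`: the eigenspace decomposition and its dimensions -/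

/-- `2 ≠ 0`: `ker(S − 1) ⊓ ker(S + 1) = ⊥` (`Sv = v = −v ⇒ 2v = 0`). -/
theorem ker_SbC_swap_sub_one_inf_add_one_eq_bot (h2 : (2 : K) ≠ 0) :
    LinearMap.ker (SbC K 0 1 1 0 (n := n) - 1) ⊓ LinearMap.ker (SbC K 0 1 1 0 (n := n) + 1) = ⊥ := by
  rw [eq_bot_iff]
  intro v hv
  obtain ⟨h₁, h₂⟩ := Submodule.mem_inf.mp hv
  rw [LinearMap.mem_ker, LinearMap.sub_apply, Module.End.one_apply, sub_eq_zero] at h₁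
  rw [LinearMap.mem_ker, LinearMap.add_apply, Module.End.one_apply, h₁, ← two_smul K v, smul_eq_zero] at h₂
  exact (Submodule.mem_bot K).mpr (h₂.resolve_left h2)

/-- every class splits as `v = ½(v + Sv) + ½(v − Sv)`: `ker(S − 1) ⊔ ker(S + 1) = ⊤` (`2 ≠ 0`, `S² = 1`). -/
theorem ker_SbC_swap_sub_one_sup_add_one_eq_top (h2 : (2 : K) ≠ 0) :
    LinearMap.ker (SbC K 0 1 1 0 (n := n) - 1) ⊔ LinearMap.ker (SbC K 0 1 1 0 (n := n) + 1) = ⊤ := by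
  rw [eq_top_iff]
  intro v _
  have hSS : ∀ u : spikeSpan K n, SbC K 0 1 1 0 (SbC K 0 1 1 0 u) = u := fun u => by rw [← Module.End.mul_apply, SbC_swap_mul_swap, Module.End.one_apply]
  have e : v = (2 : K)⁻¹ • (v + SbC K 0 1 1 0 v) + (2 : K)⁻¹ • (v - SbC K 0 1 1 0 v) := by
    rw [← smul_add, add_add_sub_cancel, ← two_smul K v, smul_smul, inv_mul_cancel₀ h2, one_smul]
  rw [e]
  refine Submodule.add_mem _ (Submodule.mem_sup_left (Submodule.smul_mem _ _ ?_)) (Submodule.mem_sup_right (Submodule.smul_mem _ _ ?_))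
  · rw [LinearMap.mem_ker, LinearMap.sub_apply, Module.End.one_apply, map_add, hSS, add_comm, sub_self]
  · rw [LinearMap.mem_ker, LinearMap.add_apply, Module.End.one_apply, map_sub, hSS, sub_add_sub_cancel', sub_self]

/-- **the palindromes `E_a + E_{rev a}`, `a ≤ n/2`, are linearly independent fixed classes** (`2 ≠ 0`; pivot at `a`, coordinate `1` or `2`). -/
theorem linearIndependent_spike_add_rev (h2 : (2 : K) ≠ 0) :
    LinearIndependent K fun a : {a : Fin (n + 1) // (a : ℕ) ≤ n / 2} => spikeBasis K n a + spikeBasis K n (Fin.rev (a : Fin (n + 1))) := by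
  classical
  refine linearIndependent_of_repr_pivot K (I := fun a : Fin (n + 1) => (a : ℕ) ≤ n / 2) _ 0 (fun a b hb => ?_) fun a => ?_
  · rw [map_add, Finsupp.add_apply, Basis.repr_self, Basis.repr_self, Finsupp.single_apply, Finsupp.single_apply, if_neg, if_neg, add_zero]
    · intro e; rw [← e, Fin.val_rev] at hb; have := a.2; omega
    · intro e; rw [← e] at hb; omega
  · refine ⟨(a : Fin (n + 1)), by omega, ?_⟩
    rw [map_add, Finsupp.add_apply, Basis.repr_self, Basis.repr_self, Finsupp.single_eq_same, Finsupp.single_apply]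
    by_cases e : Fin.rev (a : Fin (n + 1)) = (a : Fin (n + 1))
    · rw [if_pos e, ← two_mul, mul_one]; exact h2
    · rw [if_neg e, add_zero]; exact one_ne_zero

/-- **the anti-palindromes `E_a − E_{rev a}`, `2a < n`, are linearly independent anti-fixed classes** (every field; pivot `1` at `a`). -/
theorem linearIndependent_spike_sub_rev :
    LinearIndependent K fun a : {a : Fin (n + 1) // 2 * (a : ℕ) < n} => spikeBasis K n a - spikeBasis K n (Fin.rev (a : Fin (n + 1))) := by
  classical
  refine linearIndependent_of_repr_pivot K (I := fun a : Fin (n + 1) => 2 * (a : ℕ) < n) _ 0 (fun a b hb => ?_) fun a => ?_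
  · rw [map_sub, Finsupp.sub_apply, Basis.repr_self, Basis.repr_self, Finsupp.single_apply, Finsupp.single_apply, if_neg, if_neg, sub_zero]
    · intro e; rw [← e, Fin.val_rev] at hb; have := a.2; omega
    · intro e; rw [← e] at hb; omega
  · refine ⟨(a : Fin (n + 1)), by omega, ?_⟩
    rw [map_sub, Finsupp.sub_apply, Basis.repr_self, Basis.repr_self, Finsupp.single_eq_same, Finsupp.single_apply, if_neg, sub_zero]
    · exact one_ne_zero
    · intro e; have h := congrArg Fin.val e; rw [Fin.val_rev] at h; have := a.2; omega

/-- the palindromes lie in `ker(S − 1)`. -/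
theorem spike_add_rev_mem_ker (a : Fin (n + 1)) : spikeBasis K n a + spikeBasis K n (Fin.rev a) ∈ LinearMap.ker (SbC K 0 1 1 0 (n := n) - 1) := by
  rw [LinearMap.mem_ker, LinearMap.sub_apply, Module.End.one_apply, map_add, SbC_swap_spikeBasis, SbC_swap_spikeBasis, Fin.rev_rev, add_comm, sub_self]

/-- the anti-palindromes lie in `ker(S + 1)`. -/
theorem spike_sub_rev_mem_ker (a : Fin (n + 1)) : spikeBasis K n a - spikeBasis K n (Fin.rev a) ∈ LinearMap.ker (SbC K 0 1 1 0 (n := n) + 1) := by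
  rw [LinearMap.mem_ker, LinearMap.add_apply, Module.End.one_apply, map_sub, SbC_swap_spikeBasis, SbC_swap_spikeBasis, Fin.rev_rev, sub_add_sub_cancel', sub_self]

/-- `n/2 + 1 ≤ dim ker(S − 1)` (`2 ≠ 0`). -/
theorem div_two_succ_le_finrank_ker_SbC_swap_sub_one (h2 : (2 : K) ≠ 0) : n / 2 + 1 ≤ finrank K ↥(LinearMap.ker (SbC K 0 1 1 0 (n := n) - 1)) := by
  classical
  have hli := linearIndependent_spike_add_rev K (n := n) h2
  let v : {a : Fin (n + 1) // (a : ℕ) ≤ n / 2} → ↥(LinearMap.ker (SbC K 0 1 1 0 (n := n) - 1)) := fun a => ⟨_, spike_add_rev_mem_ker K (a : Fin (n + 1))⟩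
  have hv : LinearIndependent K v := LinearIndependent.of_comp (LinearMap.ker (SbC K 0 1 1 0 (n := n) - 1)).subtype hli
  refine le_trans ?_ hv.fintype_card_le_finrank
  let ι : Fin (n / 2 + 1) → {a : Fin (n + 1) // (a : ℕ) ≤ n / 2} := fun j => ⟨⟨j, by omega⟩, by show (j : ℕ) ≤ n / 2; omega⟩
  have hι : Function.Injective ι := fun j j' e => Fin.ext (by simpa [ι] using congrArg (fun x => ((x.1 : Fin (n + 1)) : ℕ)) e)
  have h := Fintype.card_le_of_injective ι hι
  rwa [Fintype.card_fin] at h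

/-- `(n+1)/2 ≤ dim ker(S + 1)` (every field). -/
theorem succ_div_two_le_finrank_ker_SbC_swap_add_one : (n + 1) / 2 ≤ finrank K ↥(LinearMap.ker (SbC K 0 1 1 0 (n := n) + 1)) := by
  classical
  have hli := linearIndependent_spike_sub_rev K (n := n)
  let v : {a : Fin (n + 1) // 2 * (a : ℕ) < n} → ↥(LinearMap.ker (SbC K 0 1 1 0 (n := n) + 1)) := fun a => ⟨_, spike_sub_rev_mem_ker K (a : Fin (n + 1))⟩
  have hv : LinearIndependent K v := LinearIndependent.of_comp (LinearMap.ker (SbC K 0 1 1 0 (n := n) + 1)).subtype hli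
  refine le_trans ?_ hv.fintype_card_le_finrank
  let ι : Fin ((n + 1) / 2) → {a : Fin (n + 1) // 2 * (a : ℕ) < n} := fun j => ⟨⟨j, by omega⟩, by show 2 * (j : ℕ) < n; omega⟩
  have hι : Function.Injective ι := fun j j' e => Fin.ext (by simpa [ι] using congrArg (fun x => ((x.1 : Fin (n + 1)) : ℕ)) e)
  have h := Fintype.card_le_of_injective ι hι
  rwa [Fintype.card_fin] at h

/-- **`dim ker(SbC(0 1 1 0) − 1) = n/2 + 1` — the palindromic classes** (`2 ≠ 0`; `⌊n/2⌋ + 1`). -/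
theorem finrank_ker_SbC_swap_sub_one (h2 : (2 : K) ≠ 0) : finrank K ↥(LinearMap.ker (SbC K 0 1 1 0 (n := n) - 1)) = n / 2 + 1 := by
  have h1 := div_two_succ_le_finrank_ker_SbC_swap_sub_one K (n := n) h2
  have h3 := succ_div_two_le_finrank_ker_SbC_swap_add_one K (n := n)
  have h4 := Submodule.finrank_sup_add_finrank_inf_eq (LinearMap.ker (SbC K 0 1 1 0 (n := n) - 1)) (LinearMap.ker (SbC K 0 1 1 0 (n := n) + 1))
  rw [ker_SbC_swap_sub_one_inf_add_one_eq_bot K h2, finrank_bot, add_zero, ker_SbC_swap_sub_one_sup_add_one_eq_top K h2, finrank_top,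
    finrank_eq_card_basis (spikeBasis K n), Fintype.card_fin] at h4
  omega

/-- **`dim ker(SbC(0 1 1 0) + 1) = (n+1)/2` — the anti-palindromic classes** (`2 ≠ 0`; `⌈n/2⌉`). -/
theorem finrank_ker_SbC_swap_add_one (h2 : (2 : K) ≠ 0) : finrank K ↥(LinearMap.ker (SbC K 0 1 1 0 (n := n) + 1)) = (n + 1) / 2 := by
  have h1 := div_two_succ_le_finrank_ker_SbC_swap_sub_one K (n := n) h2
  have h3 := succ_div_two_le_finrank_ker_SbC_swap_add_one K (n := n)
  have h4 := Submodule.finrank_sup_add_finrank_inf_eq (LinearMap.ker (SbC K 0 1 1 0 (n := n) - 1)) (LinearMap.ker (SbC K 0 1 1 0 (n := n) + 1))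
  rw [ker_SbC_swap_sub_one_inf_add_one_eq_bot K h2, finrank_bot, add_zero, ker_SbC_swap_sub_one_sup_add_one_eq_top K h2, finrank_top,
    finrank_eq_card_basis (spikeBasis K n), Fintype.card_fin] at h4
  omega

end Summit.Ventures.HSemireg.Wedge.HankelFrameChange
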